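import Literature.AlgebraicGeometry.Motives.MixedHodgeExtensionTensorClassLeft
import Literature.AlgebraicGeometry.Motives.MixedHodgeExtensionTateTwist
import Literature.AlgebraicGeometry.Motives.MixedHodgeStructureTensorTate
import HarnessLib

/-!
# Tate twists of extensions are tensor products with `ℚ(j)`: `ℚ(j) ⊗ E ≅ E(j)`, `ℚ(0) ⊗ E ≅ E`

Deligne, *Théorie de Hodge II*, 2.1.13–2.1.14: the Tate twist is `H(n) = H ⊗ ℤ(n)`; the tree has the
isomorphism of mixed Hodge structures `tateTensorHom H j : ℚ(j) ⊗ H ≅ H(j)` (`q ⊗ v ↦ q • v`) and the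
unit `unitTensorHom H : ℚ(0) ⊗ H ≅ H` (`MixedHodgeStructureTensorTate`), the twisted extension
`E(n) = Extension.tateTwist E n` with `Ext.tateTwistEquiv n : Ext(A, B) ≃ Ext(A(n), B(n))`
(`MixedHodgeExtensionTateTwist`), and the tensored extensions `C ⊗ E`, `E ⊗ C` with
`Ext.lTensorMap`, `Ext.rTensorMap` (`MixedHodgeExtensionTensor`, `…TensorClass`, `…TensorClassLeft`).
Mac Lane, *Homology*, III Prop. 1.8: a morphism of extensions `(β, φ, α) : E → E'` yields a congruence
`β_* E ≡ α^* E'`. This file identifies the two constructions: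

* §1 **Mac Lane III Prop. 1.8 on `Ext`, arbitrary pairs**: `β_* [E] = α^* [E']` for any morphism
  `(β, φ, α) : E → E'` (`Ext.pushoutMapW_mkOfW_eq_pullbackMapW_mkOfW`), and as a congruence
  `β_* E ≡ α^* E'`.
* §2 the morphisms of extensions **`ℚ(j) ⊗ E → E(j)`** and `E(j) → ℚ(j) ⊗ E` (components `tateTensorHom`,
  `tateTensorInv`), and `ℚ(0) ⊗ E → E`, `E ⊗ ℚ(0) → E`;
* §3 **`(ℚ(j) ⊗ B ≅ B(j))_* (ℚ(j) ⊗ x) = (ℚ(j) ⊗ A ≅ A(j))^* (x(j))`** on `Ext`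
  (`Ext.pushoutMapW_tateTensorHom_lTensorMap`), the solved forms
  `ℚ(j) ⊗ x = (≅)^* (≅⁻¹)_* x(j)` and `x(j) = (≅⁻¹)^* (≅)_* (ℚ(j) ⊗ x)`, the congruence
  `(≅)_* (ℚ(j) ⊗ E) ≡ (≅)^* E(j)`, and split iff;
* §4 the unit: **`(ℚ(0) ⊗ B ≅ B)_* (ℚ(0) ⊗ x) = (ℚ(0) ⊗ A ≅ A)^* x`** and the right-handed
  `(B ⊗ ℚ(0) ≅ B)_* (x ⊗ ℚ(0)) = (A ⊗ ℚ(0) ≅ A)^* x`.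

All statements proved; no named facts.

## References

* [DeligneHodgeII1971] P. Deligne, Théorie de Hodge II, 2.1.13–2.1.14.
* [MacLane1963Homology] S. Mac Lane, Homology (1963), Ch. III §1 Prop. 1.8, Lemmas 1.2, 1.4.
* [BrylinskiZucker1998] J.-L. Brylinski, S. Zucker, An overview of recent advances in Hodge theory,
  Prop. 5.22.
* [Jannsen1990MixedMotives] U. Jannsen, Mixed Motives and Algebraic K-Theory, LNM 1400 (1990), §9
  Remark 9.3 a).
-/

open scoped TensorProduct

noncomputable section

namespace Literature.AlgebraicGeometry.Motives

namespace MixedHodgeStructure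

open HodgeStructure (tate)

universe u v w w' u' v'

variable {VA : Type u} [AddCommGroup VA] [Module ℚ VA] [FiniteDimensional ℚ VA]
variable {VB : Type v} [AddCommGroup VB] [Module ℚ VB] [FiniteDimensional ℚ VB]
variable {VA' : Type u'} [AddCommGroup VA'] [Module ℚ VA'] [FiniteDimensional ℚ VA']
variable {VB' : Type v'} [AddCommGroup VB'] [Module ℚ VB'] [FiniteDimensional ℚ VB']
variable {VE : Type w} [AddCommGroup VE] [Module ℚ VE] [FiniteDimensional ℚ VE]
variable {VE' : Type w'} [AddCommGroup VE'] [Module ℚ VE'] [FiniteDimensional ℚ VE']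

/-! ### §1 Mac Lane III Prop. 1.8 on `Ext`, arbitrary pairs -/

section MacLane

variable {A : MixedHodgeStructure VA} {B : MixedHodgeStructure VB}
variable {A' : MixedHodgeStructure VA'} {B' : MixedHodgeStructure VB'}
variable {E : Extension A B VE} {E' : Extension A' B' VE'}

omit [FiniteDimensional ℚ VA] [FiniteDimensional ℚ VB] [FiniteDimensional ℚ VA'] [FiniteDimensional ℚ VB']
  [FiniteDimensional ℚ VE] [FiniteDimensional ℚ VE'] in
/-- **Mac Lane III Prop. 1.8 on `Ext` (arbitrary pairs)**: a morphism of extensions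
`(β, φ, α) : E → E'` gives `β_* [E] = α^* [E']` in `Ext(A, B')` ("any morphism `(α, β, γ) : E → E'`
implies a congruence `αE ≡ E'γ`"). [cite: MacLane1963Homology, Ch. III Prop. 1.8] -/
theorem Ext.pushoutMapW_mkOfW_eq_pullbackMapW_mkOfW (m : Extension.Morphism E E') :
    Ext.pushoutMapW m.left (Ext.mkOfW E) = Ext.pullbackMapW m.right (Ext.mkOfW E') :=
  Ext.extEquivJHomW.injective (by
    rw [Ext.extEquivJHomW_pushoutMapW, Ext.clsW_mkOfW, Ext.extEquivJHomW_pullbackMapW, Ext.clsW_mkOfW,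
      m.postcomp_clsW_eq_precomp_clsW])

omit [FiniteDimensional ℚ VA] [FiniteDimensional ℚ VB] [FiniteDimensional ℚ VA'] [FiniteDimensional ℚ VB']
  [FiniteDimensional ℚ VE] [FiniteDimensional ℚ VE'] in
/-- **`β_* E ≡ α^* E'`** for a morphism `(β, φ, α) : E → E'` of extensions of arbitrary mixed Hodge
structures. [cite: MacLane1963Homology, Ch. III Prop. 1.8] -/
theorem Extension.nonempty_congruence_pushout_pullback_of_morphism (m : Extension.Morphism E E') :
    Nonempty (Extension.Congruence (E.pushout m.left) (E'.pullback m.right)) := by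
  rw [← Ext.mkOfW_eq_mkOfW_iff, ← Ext.pushoutMapW_mkOfW, ← Ext.pullbackMapW_mkOfW]
  exact Ext.pushoutMapW_mkOfW_eq_pullbackMapW_mkOfW m

end MacLane

/-! ### §2 The morphisms `ℚ(j) ⊗ E → E(j)`, `E(j) → ℚ(j) ⊗ E`, `ℚ(0) ⊗ E → E`, `E ⊗ ℚ(0) → E` -/

namespace Extension

variable {A : MixedHodgeStructure VA} {B : MixedHodgeStructure VB} (E : Extension A B VE) (j : ℤ)

omit [FiniteDimensional ℚ VA'] [FiniteDimensional ℚ VB'] [FiniteDimensional ℚ VE'] [AddCommGroup VA']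
  [Module ℚ VA'] [AddCommGroup VB'] [Module ℚ VB'] [AddCommGroup VE'] [Module ℚ VE'] in
/-- **The morphism of extensions `ℚ(j) ⊗ E → E(j)`** with components the isomorphisms
`ℚ(j) ⊗ H ≅ H(j)`, `q ⊗ v ↦ q • v` (Deligne 2.1.13: `H(n) = H ⊗ ℤ(n)`). [cite: DeligneHodgeII1971, 2.1.13] -/
def lTensorTateToTateTwist :
    Morphism (E.lTensor (tate j).toMixedHodgeStructure) (E.tateTwist j) where
  left := tateTensorHom B j
  mid := tateTensorHom E.mhs j
  right := tateTensorHom A j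
  mid_inc := TensorProduct.ext' fun q b => by
    change TensorProduct.lid ℚ VE (q ⊗ₜ[ℚ] E.inc.toLinearMap b) = E.inc.toLinearMap (TensorProduct.lid ℚ VB (q ⊗ₜ[ℚ] b))
    rw [TensorProduct.lid_tmul, TensorProduct.lid_tmul, map_smul]
  proj_mid := TensorProduct.ext' fun q e => by
    change E.proj.toLinearMap (TensorProduct.lid ℚ VE (q ⊗ₜ[ℚ] e)) = TensorProduct.lid ℚ VA (q ⊗ₜ[ℚ] E.proj.toLinearMap e)
    rw [TensorProduct.lid_tmul, TensorProduct.lid_tmul, map_smul]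

omit [FiniteDimensional ℚ VA'] [FiniteDimensional ℚ VB'] [FiniteDimensional ℚ VE'] [AddCommGroup VA']
  [Module ℚ VA'] [AddCommGroup VB'] [Module ℚ VB'] [AddCommGroup VE'] [Module ℚ VE'] in
/-- The components of `ℚ(j) ⊗ E → E(j)` (by `rfl`). [cite: DeligneHodgeII1971, 2.1.13] -/
@[simp]
theorem lTensorTateToTateTwist_left : (E.lTensorTateToTateTwist j).left = tateTensorHom B j := rfl

omit [FiniteDimensional ℚ VA'] [FiniteDimensional ℚ VB'] [FiniteDimensional ℚ VE'] [AddCommGroup VA']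
  [Module ℚ VA'] [AddCommGroup VB'] [Module ℚ VB'] [AddCommGroup VE'] [Module ℚ VE'] in
/-- The components of `ℚ(j) ⊗ E → E(j)` (by `rfl`). [cite: DeligneHodgeII1971, 2.1.13] -/
@[simp]
theorem lTensorTateToTateTwist_right : (E.lTensorTateToTateTwist j).right = tateTensorHom A j := rfl

omit [FiniteDimensional ℚ VA'] [FiniteDimensional ℚ VB'] [FiniteDimensional ℚ VE'] [AddCommGroup VA']
  [Module ℚ VA'] [AddCommGroup VB'] [Module ℚ VB'] [AddCommGroup VE'] [Module ℚ VE'] in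
/-- **The inverse morphism `E(j) → ℚ(j) ⊗ E`**, components `v ↦ 1 ⊗ v`. [cite: DeligneHodgeII1971, 2.1.13] -/
def tateTwistToLTensorTate :
    Morphism (E.tateTwist j) (E.lTensor (tate j).toMixedHodgeStructure) where
  left := tateTensorInv B j
  mid := tateTensorInv E.mhs j
  right := tateTensorInv A j
  mid_inc := LinearMap.ext fun b => by
    change (TensorProduct.lid ℚ VE).symm (E.inc.toLinearMap b) =
      TensorProduct.map LinearMap.id E.inc.toLinearMap ((TensorProduct.lid ℚ VB).symm b)
    rw [TensorProduct.lid_symm_apply, TensorProduct.lid_symm_apply, TensorProduct.map_tmul, LinearMap.id_apply]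
  proj_mid := LinearMap.ext fun e => by
    change TensorProduct.map LinearMap.id E.proj.toLinearMap ((TensorProduct.lid ℚ VE).symm e) =
      (TensorProduct.lid ℚ VA).symm (E.proj.toLinearMap e)
    rw [TensorProduct.lid_symm_apply, TensorProduct.lid_symm_apply, TensorProduct.map_tmul, LinearMap.id_apply]

omit [FiniteDimensional ℚ VA'] [FiniteDimensional ℚ VB'] [FiniteDimensional ℚ VE'] [AddCommGroup VA']
  [Module ℚ VA'] [AddCommGroup VB'] [Module ℚ VB'] [AddCommGroup VE'] [Module ℚ VE'] in
/-- The components of `E(j) → ℚ(j) ⊗ E` (by `rfl`). [cite: DeligneHodgeII1971, 2.1.13] -/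
@[simp]
theorem tateTwistToLTensorTate_left : (E.tateTwistToLTensorTate j).left = tateTensorInv B j := rfl

omit [FiniteDimensional ℚ VA'] [FiniteDimensional ℚ VB'] [FiniteDimensional ℚ VE'] [AddCommGroup VA']
  [Module ℚ VA'] [AddCommGroup VB'] [Module ℚ VB'] [AddCommGroup VE'] [Module ℚ VE'] in
/-- The components of `E(j) → ℚ(j) ⊗ E` (by `rfl`). [cite: DeligneHodgeII1971, 2.1.13] -/
@[simp]
theorem tateTwistToLTensorTate_right : (E.tateTwistToLTensorTate j).right = tateTensorInv A j := rfl

omit [FiniteDimensional ℚ VA'] [FiniteDimensional ℚ VB'] [FiniteDimensional ℚ VE'] [AddCommGroup VA']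
  [Module ℚ VA'] [AddCommGroup VB'] [Module ℚ VB'] [AddCommGroup VE'] [Module ℚ VE'] in
/-- **The unit morphism of extensions `ℚ(0) ⊗ E → E`**, components `q ⊗ v ↦ q • v`.
[cite: DeligneHodgeII1971, 2.1.13] -/
def lTensorUnitToSelf : Morphism (E.lTensor (tate 0).toMixedHodgeStructure) E where
  left := unitTensorHom B
  mid := unitTensorHom E.mhs
  right := unitTensorHom A
  mid_inc := TensorProduct.ext' fun q b => by
    change TensorProduct.lid ℚ VE (q ⊗ₜ[ℚ] E.inc.toLinearMap b) = E.inc.toLinearMap (TensorProduct.lid ℚ VB (q ⊗ₜ[ℚ] b))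
    rw [TensorProduct.lid_tmul, TensorProduct.lid_tmul, map_smul]
  proj_mid := TensorProduct.ext' fun q e => by
    change E.proj.toLinearMap (TensorProduct.lid ℚ VE (q ⊗ₜ[ℚ] e)) = TensorProduct.lid ℚ VA (q ⊗ₜ[ℚ] E.proj.toLinearMap e)
    rw [TensorProduct.lid_tmul, TensorProduct.lid_tmul, map_smul]

omit [FiniteDimensional ℚ VA'] [FiniteDimensional ℚ VB'] [FiniteDimensional ℚ VE'] [AddCommGroup VA']
  [Module ℚ VA'] [AddCommGroup VB'] [Module ℚ VB'] [AddCommGroup VE'] [Module ℚ VE'] in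
/-- The components of `ℚ(0) ⊗ E → E` (by `rfl`). [cite: DeligneHodgeII1971, 2.1.13] -/
@[simp]
theorem lTensorUnitToSelf_left : E.lTensorUnitToSelf.left = unitTensorHom B := rfl

omit [FiniteDimensional ℚ VA'] [FiniteDimensional ℚ VB'] [FiniteDimensional ℚ VE'] [AddCommGroup VA']
  [Module ℚ VA'] [AddCommGroup VB'] [Module ℚ VB'] [AddCommGroup VE'] [Module ℚ VE'] in
/-- The components of `ℚ(0) ⊗ E → E` (by `rfl`). [cite: DeligneHodgeII1971, 2.1.13] -/
@[simp]
theorem lTensorUnitToSelf_right : E.lTensorUnitToSelf.right = unitTensorHom A := rfl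

omit [FiniteDimensional ℚ VA'] [FiniteDimensional ℚ VB'] [FiniteDimensional ℚ VE'] [AddCommGroup VA']
  [Module ℚ VA'] [AddCommGroup VB'] [Module ℚ VB'] [AddCommGroup VE'] [Module ℚ VE'] in
/-- **The unit morphism `E ⊗ ℚ(0) → E`** (symmetry followed by `ℚ(0) ⊗ E → E`).
[cite: DeligneHodgeII1971, 2.1.13] -/
def rTensorUnitToSelf : Morphism (E.rTensor (tate 0).toMixedHodgeStructure) E :=
  E.lTensorUnitToSelf.comp (E.rTensorToLTensor (tate 0).toMixedHodgeStructure)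

omit [FiniteDimensional ℚ VA'] [FiniteDimensional ℚ VB'] [FiniteDimensional ℚ VE'] [AddCommGroup VA']
  [Module ℚ VA'] [AddCommGroup VB'] [Module ℚ VB'] [AddCommGroup VE'] [Module ℚ VE'] in
/-- The components of `E ⊗ ℚ(0) → E` (by `rfl`). [cite: DeligneHodgeII1971, 2.1.13] -/
theorem rTensorUnitToSelf_left :
    E.rTensorUnitToSelf.left = (unitTensorHom B).comp (tensorComm B (tate 0).toMixedHodgeStructure) := rfl

omit [FiniteDimensional ℚ VA'] [FiniteDimensional ℚ VB'] [FiniteDimensional ℚ VE'] [AddCommGroup VA']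
  [Module ℚ VA'] [AddCommGroup VB'] [Module ℚ VB'] [AddCommGroup VE'] [Module ℚ VE'] in
/-- The components of `E ⊗ ℚ(0) → E` (by `rfl`). [cite: DeligneHodgeII1971, 2.1.13] -/
theorem rTensorUnitToSelf_right :
    E.rTensorUnitToSelf.right = (unitTensorHom A).comp (tensorComm A (tate 0).toMixedHodgeStructure) := rfl

/-! ### §3 `ℚ(j) ⊗ E` versus `E(j)` -/

omit [FiniteDimensional ℚ VA'] [FiniteDimensional ℚ VB'] [FiniteDimensional ℚ VE'] [AddCommGroup VA']
  [Module ℚ VA'] [AddCommGroup VB'] [Module ℚ VB'] [AddCommGroup VE'] [Module ℚ VE'] in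
/-- **`(ℚ(j) ⊗ B ≅ B(j))_* (ℚ(j) ⊗ E) ≡ (ℚ(j) ⊗ A ≅ A(j))^* E(j)`** (Mac Lane III Prop. 1.8 along
`ℚ(j) ⊗ E → E(j)`). [cite: DeligneHodgeII1971, 2.1.13] [cite: MacLane1963Homology, Ch. III Prop. 1.8] -/
theorem nonempty_congruence_lTensor_tate_tateTwist :
    Nonempty (Congruence ((E.lTensor (tate j).toMixedHodgeStructure).pushout (tateTensorHom B j))
      ((E.tateTwist j).pullback (tateTensorHom A j))) :=
  nonempty_congruence_pushout_pullback_of_morphism (E.lTensorTateToTateTwist j)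

omit [FiniteDimensional ℚ VA'] [FiniteDimensional ℚ VB'] [FiniteDimensional ℚ VE'] [AddCommGroup VA']
  [Module ℚ VA'] [AddCommGroup VB'] [Module ℚ VB'] [AddCommGroup VE'] [Module ℚ VE'] in
/-- Conversely `(B(j) ≅ ℚ(j) ⊗ B)_* E(j) ≡ (A(j) ≅ ℚ(j) ⊗ A)^* (ℚ(j) ⊗ E)`.
[cite: DeligneHodgeII1971, 2.1.13] [cite: MacLane1963Homology, Ch. III Prop. 1.8] -/
theorem nonempty_congruence_tateTwist_lTensor_tate :
    Nonempty (Congruence ((E.tateTwist j).pushout (tateTensorInv B j))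
      ((E.lTensor (tate j).toMixedHodgeStructure).pullback (tateTensorInv A j))) :=
  nonempty_congruence_pushout_pullback_of_morphism (E.tateTwistToLTensorTate j)

omit [FiniteDimensional ℚ VA'] [FiniteDimensional ℚ VB'] [FiniteDimensional ℚ VE'] [AddCommGroup VA']
  [Module ℚ VA'] [AddCommGroup VB'] [Module ℚ VB'] [AddCommGroup VE'] [Module ℚ VE'] in
/-- **`ℚ(j) ⊗ E` splits iff `E(j)` splits iff `E` splits.** [cite: DeligneHodgeII1971, 2.1.13] -/
theorem isSplit_lTensor_tate_iff : (E.lTensor (tate j).toMixedHodgeStructure).IsSplit ↔ E.IsSplit := by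
  rw [← E.isSplit_tateTwist_iff j, ← Ext.mkOfW_eq_zeroW_iff, ← Ext.mkOfW_eq_zeroW_iff]
  have h := Ext.pushoutMapW_mkOfW_eq_pullbackMapW_mkOfW (E.lTensorTateToTateTwist j)
  rw [lTensorTateToTateTwist_left, lTensorTateToTateTwist_right] at h
  constructor
  · intro h0
    have h1 : Ext.pullbackMapW (tateTensorHom A j) (Ext.mkOfW (E.tateTwist j)) = Ext.zeroW := by
      rw [← h, h0, Ext.pushoutMapW_zeroW]
    have h2 := congrArg (Ext.pullbackMapW (tateTensorInv A j)) h1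
    rwa [← Ext.pullbackMapW_comp, tateTensorHom_comp_tateTensorInv, Ext.pullbackMapW_id,
      Ext.pullbackMapW_zeroW] at h2
  · intro h0
    have h1 : Ext.pushoutMapW (tateTensorHom B j) (Ext.mkOfW (E.lTensor (tate j).toMixedHodgeStructure)) =
        Ext.zeroW := by
      rw [h, h0, Ext.pullbackMapW_zeroW]
    have h2 := congrArg (Ext.pushoutMapW (tateTensorInv B j)) h1
    rwa [← Ext.pushoutMapW_comp, tateTensorInv_comp_tateTensorHom, Ext.pushoutMapW_id,
      Ext.pushoutMapW_zeroW] at h2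

omit [FiniteDimensional ℚ VA'] [FiniteDimensional ℚ VB'] [FiniteDimensional ℚ VE'] [AddCommGroup VA']
  [Module ℚ VA'] [AddCommGroup VB'] [Module ℚ VB'] [AddCommGroup VE'] [Module ℚ VE'] in
/-- **`E ⊗ ℚ(j)` splits iff `E` splits.** [cite: DeligneHodgeII1971, 2.1.13] -/
theorem isSplit_rTensor_tate_iff : (E.rTensor (tate j).toMixedHodgeStructure).IsSplit ↔ E.IsSplit := by
  rw [← isSplit_lTensor_iff_isSplit_rTensor, isSplit_lTensor_tate_iff]

end Extension

namespace Ext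

variable {A : MixedHodgeStructure VA} {B : MixedHodgeStructure VB} (j : ℤ)

omit [FiniteDimensional ℚ VA'] [FiniteDimensional ℚ VB'] [FiniteDimensional ℚ VE] [FiniteDimensional ℚ VE']
  [AddCommGroup VA'] [Module ℚ VA'] [AddCommGroup VB'] [Module ℚ VB'] [AddCommGroup VE] [Module ℚ VE]
  [AddCommGroup VE'] [Module ℚ VE'] in
/-- **`(ℚ(j) ⊗ B ≅ B(j))_* (ℚ(j) ⊗ x) = (ℚ(j) ⊗ A ≅ A(j))^* x(j)`** on `Ext`: tensoring with `ℚ(j)`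
is the Tate twist, up to the canonical isomorphisms `q ⊗ v ↦ q • v` (Deligne 2.1.13).
[cite: DeligneHodgeII1971, 2.1.13] [cite: MacLane1963Homology, Ch. III Prop. 1.8] -/
theorem pushoutMapW_tateTensorHom_lTensorMap (x : Ext A B) :
    pushoutMapW (tateTensorHom B j) (lTensorMap (tate j).toMixedHodgeStructure x) =
      pullbackMapW (tateTensorHom A j) (tateTwistEquiv j x) := by
  obtain ⟨E, rfl⟩ := exists_mkOfW_eq x
  rw [lTensorMap_mkOfW, tateTwistEquiv_mkOfW]
  exact pushoutMapW_mkOfW_eq_pullbackMapW_mkOfW (E.lTensorTateToTateTwist j)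

omit [FiniteDimensional ℚ VA'] [FiniteDimensional ℚ VB'] [FiniteDimensional ℚ VE] [FiniteDimensional ℚ VE']
  [AddCommGroup VA'] [Module ℚ VA'] [AddCommGroup VB'] [Module ℚ VB'] [AddCommGroup VE] [Module ℚ VE]
  [AddCommGroup VE'] [Module ℚ VE'] in
/-- `(B(j) ≅ ℚ(j) ⊗ B)_* x(j) = (A(j) ≅ ℚ(j) ⊗ A)^* (ℚ(j) ⊗ x)`. [cite: DeligneHodgeII1971, 2.1.13]
[cite: MacLane1963Homology, Ch. III Prop. 1.8] -/
theorem pushoutMapW_tateTensorInv_tateTwistEquiv (x : Ext A B) :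
    pushoutMapW (tateTensorInv B j) (tateTwistEquiv j x) =
      pullbackMapW (tateTensorInv A j) (lTensorMap (tate j).toMixedHodgeStructure x) := by
  obtain ⟨E, rfl⟩ := exists_mkOfW_eq x
  rw [lTensorMap_mkOfW, tateTwistEquiv_mkOfW]
  exact pushoutMapW_mkOfW_eq_pullbackMapW_mkOfW (E.tateTwistToLTensorTate j)

omit [FiniteDimensional ℚ VA'] [FiniteDimensional ℚ VB'] [FiniteDimensional ℚ VE] [FiniteDimensional ℚ VE']
  [AddCommGroup VA'] [Module ℚ VA'] [AddCommGroup VB'] [Module ℚ VB'] [AddCommGroup VE] [Module ℚ VE]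
  [AddCommGroup VE'] [Module ℚ VE'] in
/-- **`ℚ(j) ⊗ x = (ℚ(j) ⊗ A ≅ A(j))^* (B(j) ≅ ℚ(j) ⊗ B)_* x(j)`**: `Ext.lTensorMap ℚ(j)` expressed
through `Ext.tateTwistEquiv j`. [cite: DeligneHodgeII1971, 2.1.13] -/
theorem lTensorMap_tate_eq (x : Ext A B) :
    lTensorMap (tate j).toMixedHodgeStructure x =
      pullbackMapW (tateTensorHom A j) (pushoutMapW (tateTensorInv B j) (tateTwistEquiv j x)) := by
  rw [pushoutMapW_tateTensorInv_tateTwistEquiv, ← pullbackMapW_comp, tateTensorInv_comp_tateTensorHom,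
    pullbackMapW_id]

omit [FiniteDimensional ℚ VA'] [FiniteDimensional ℚ VB'] [FiniteDimensional ℚ VE] [FiniteDimensional ℚ VE']
  [AddCommGroup VA'] [Module ℚ VA'] [AddCommGroup VB'] [Module ℚ VB'] [AddCommGroup VE] [Module ℚ VE]
  [AddCommGroup VE'] [Module ℚ VE'] in
/-- **`x(j) = (A(j) ≅ ℚ(j) ⊗ A)^* (ℚ(j) ⊗ B ≅ B(j))_* (ℚ(j) ⊗ x)`**: the Tate twist on `Ext`
expressed through tensoring with `ℚ(j)` (Deligne 2.1.13: `H(n) = H ⊗ ℤ(n)`). [cite: DeligneHodgeII1971, 2.1.13] -/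
theorem tateTwistEquiv_eq_lTensorMap (x : Ext A B) :
    tateTwistEquiv j x =
      pullbackMapW (tateTensorInv A j) (pushoutMapW (tateTensorHom B j) (lTensorMap (tate j).toMixedHodgeStructure x)) := by
  rw [pushoutMapW_tateTensorHom_lTensorMap, ← pullbackMapW_comp, tateTensorHom_comp_tateTensorInv,
    pullbackMapW_id]

omit [FiniteDimensional ℚ VA'] [FiniteDimensional ℚ VB'] [FiniteDimensional ℚ VE] [FiniteDimensional ℚ VE']
  [AddCommGroup VA'] [Module ℚ VA'] [AddCommGroup VB'] [Module ℚ VB'] [AddCommGroup VE] [Module ℚ VE]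
  [AddCommGroup VE'] [Module ℚ VE'] in
/-- The right-handed form: `(B ⊗ ℚ(j) → B(j))_* (x ⊗ ℚ(j)) = (A ⊗ ℚ(j) → A(j))^* x(j)` with the
isomorphisms `σ` then `q ⊗ v ↦ q • v`. [cite: DeligneHodgeII1971, 2.1.13] -/
theorem pushoutMapW_tateTensorHom_tensorComm_rTensorMap (x : Ext A B) :
    pushoutMapW ((tateTensorHom B j).comp (tensorComm B (tate j).toMixedHodgeStructure))
        (rTensorMap (tate j).toMixedHodgeStructure x) =
      pullbackMapW ((tateTensorHom A j).comp (tensorComm A (tate j).toMixedHodgeStructure))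
        (tateTwistEquiv j x) := by
  obtain ⟨E, rfl⟩ := exists_mkOfW_eq x
  rw [rTensorMap_mkOfW, tateTwistEquiv_mkOfW]
  exact pushoutMapW_mkOfW_eq_pullbackMapW_mkOfW
    ((E.lTensorTateToTateTwist j).comp (E.rTensorToLTensor (tate j).toMixedHodgeStructure))

/-! ### §4 The unit `ℚ(0) ⊗ E ≅ E` on `Ext` -/

omit [FiniteDimensional ℚ VA'] [FiniteDimensional ℚ VB'] [FiniteDimensional ℚ VE] [FiniteDimensional ℚ VE']
  [AddCommGroup VA'] [Module ℚ VA'] [AddCommGroup VB'] [Module ℚ VB'] [AddCommGroup VE] [Module ℚ VE]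
  [AddCommGroup VE'] [Module ℚ VE'] in
/-- **`(ℚ(0) ⊗ B ≅ B)_* (ℚ(0) ⊗ x) = (ℚ(0) ⊗ A ≅ A)^* x`**: tensoring with the unit is the identity
up to the unit isomorphisms. [cite: DeligneHodgeII1971, 2.1.13] [cite: MacLane1963Homology, Ch. III Prop. 1.8] -/
theorem pushoutMapW_unitTensorHom_lTensorMap (x : Ext A B) :
    pushoutMapW (unitTensorHom B) (lTensorMap (tate 0).toMixedHodgeStructure x) =
      pullbackMapW (unitTensorHom A) x := by
  obtain ⟨E, rfl⟩ := exists_mkOfW_eq x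
  rw [lTensorMap_mkOfW]
  exact pushoutMapW_mkOfW_eq_pullbackMapW_mkOfW E.lTensorUnitToSelf

omit [FiniteDimensional ℚ VA'] [FiniteDimensional ℚ VB'] [FiniteDimensional ℚ VE] [FiniteDimensional ℚ VE']
  [AddCommGroup VA'] [Module ℚ VA'] [AddCommGroup VB'] [Module ℚ VB'] [AddCommGroup VE] [Module ℚ VE]
  [AddCommGroup VE'] [Module ℚ VE'] in
/-- **`ℚ(0) ⊗ x = (ℚ(0) ⊗ A ≅ A)^* (B ≅ ℚ(0) ⊗ B)_* x`.** [cite: DeligneHodgeII1971, 2.1.13] -/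
theorem lTensorMap_unit_eq (x : Ext A B) :
    lTensorMap (tate 0).toMixedHodgeStructure x =
      pullbackMapW (unitTensorHom A) (pushoutMapW (unitTensorInv B) x) := by
  have h := congrArg (pushoutMapW (unitTensorInv B)) (pushoutMapW_unitTensorHom_lTensorMap x)
  rw [← pushoutMapW_comp, unitTensorInv_comp_unitTensorHom, pushoutMapW_id, pushoutMapW_pullbackMapW] at h
  exact h

omit [FiniteDimensional ℚ VA'] [FiniteDimensional ℚ VB'] [FiniteDimensional ℚ VE] [FiniteDimensional ℚ VE']
  [AddCommGroup VA'] [Module ℚ VA'] [AddCommGroup VB'] [Module ℚ VB'] [AddCommGroup VE] [Module ℚ VE]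
  [AddCommGroup VE'] [Module ℚ VE'] in
/-- **`x = (A ≅ ℚ(0) ⊗ A)^* (ℚ(0) ⊗ B ≅ B)_* (ℚ(0) ⊗ x)`**: `x` recovered from `ℚ(0) ⊗ x`.
[cite: DeligneHodgeII1971, 2.1.13] -/
theorem eq_pullbackMapW_pushoutMapW_lTensorMap_unit (x : Ext A B) :
    x = pullbackMapW (unitTensorInv A) (pushoutMapW (unitTensorHom B) (lTensorMap (tate 0).toMixedHodgeStructure x)) := by
  rw [pushoutMapW_unitTensorHom_lTensorMap, ← pullbackMapW_comp, unitTensorHom_comp_unitTensorInv, pullbackMapW_id]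

omit [FiniteDimensional ℚ VA'] [FiniteDimensional ℚ VB'] [FiniteDimensional ℚ VE] [FiniteDimensional ℚ VE']
  [AddCommGroup VA'] [Module ℚ VA'] [AddCommGroup VB'] [Module ℚ VB'] [AddCommGroup VE] [Module ℚ VE]
  [AddCommGroup VE'] [Module ℚ VE'] in
/-- **`ℚ(0) ⊗ ·` is injective on `Ext(A, B)`.** [cite: DeligneHodgeII1971, 2.1.13] -/
theorem lTensorMap_unit_injective :
    Function.Injective (lTensorMap (A := A) (B := B) (tate 0).toMixedHodgeStructure) := by
  intro x y h
  rw [eq_pullbackMapW_pushoutMapW_lTensorMap_unit x, eq_pullbackMapW_pushoutMapW_lTensorMap_unit y, h]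

omit [FiniteDimensional ℚ VA'] [FiniteDimensional ℚ VB'] [FiniteDimensional ℚ VE] [FiniteDimensional ℚ VE']
  [AddCommGroup VA'] [Module ℚ VA'] [AddCommGroup VB'] [Module ℚ VB'] [AddCommGroup VE] [Module ℚ VE]
  [AddCommGroup VE'] [Module ℚ VE'] in
/-- The right-handed unit: **`(B ⊗ ℚ(0) → B)_* (x ⊗ ℚ(0)) = (A ⊗ ℚ(0) → A)^* x`** with the
isomorphisms `v ⊗ q ↦ q • v`. [cite: DeligneHodgeII1971, 2.1.13] [cite: MacLane1963Homology, Ch. III Prop. 1.8] -/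
theorem pushoutMapW_unitTensorHom_tensorComm_rTensorMap (x : Ext A B) :
    pushoutMapW ((unitTensorHom B).comp (tensorComm B (tate 0).toMixedHodgeStructure))
        (rTensorMap (tate 0).toMixedHodgeStructure x) =
      pullbackMapW ((unitTensorHom A).comp (tensorComm A (tate 0).toMixedHodgeStructure)) x := by
  obtain ⟨E, rfl⟩ := exists_mkOfW_eq x
  rw [rTensorMap_mkOfW]
  exact pushoutMapW_mkOfW_eq_pullbackMapW_mkOfW E.rTensorUnitToSelf

omit [FiniteDimensional ℚ VA'] [FiniteDimensional ℚ VB'] [FiniteDimensional ℚ VE] [FiniteDimensional ℚ VE']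
  [AddCommGroup VA'] [Module ℚ VA'] [AddCommGroup VB'] [Module ℚ VB'] [AddCommGroup VE] [Module ℚ VE]
  [AddCommGroup VE'] [Module ℚ VE'] in
/-- **`· ⊗ ℚ(0)` is injective on `Ext(A, B)`.** [cite: DeligneHodgeII1971, 2.1.13] -/
theorem rTensorMap_unit_injective :
    Function.Injective (rTensorMap (A := A) (B := B) (tate 0).toMixedHodgeStructure) := by
  intro x y h
  apply lTensorMap_unit_injective
  rw [lTensorMap_def, lTensorMap_def, h]

end Ext

end MixedHodgeStructure

end Literature.AlgebraicGeometry.Motives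

end
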